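import Literature.AlgebraicGeometry.AbelianSchemes.SerreTensorFunctoriality
import HarnessLib

/-!
# Reindexing the powers of an abelian scheme: `(Aⁿ)ᵐ ≅ A^{m·n}`

Topic `AlgebraicGeometry/AbelianSchemes`, namespace `Literature.AlgebraicGeometry.AbelianSchemes.AbelianSchemeOver` (constructions with
bodies + proved theorems; no named fact, no `sorry`, no `instance`, no notation; any base `S`).  Cell `hodgecm-mathlib`, F0/P6 «MOD»,
P6a organ (g2) FILE 6a (bookkeeping for the composition law `(A ⊗_𝒪 𝔞) ⊗_𝒪 𝔟 ≅ A ⊗_𝒪 (𝔞 ⊗_𝒪 𝔟)`, FILE 6b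
`SerreTensorComposition`); `--supports stmt-HodgeConjecture-24832`, count-neutral.  HC_CM is proved only modulo the 2 remaining named
inputs (hLiu418, h413) until rung 0 closes; this file discharges none of them.

## Mathematics

The iterated fibre power `(Aⁿ)ᵐ` of the abelian scheme `A/S` (FILE 1's `pow`, a chosen product in `Over S` with its product group law)
is canonically isomorphic, as a group object, to `A^{m·n}`: a point of either is a family of points of `A` indexed by `Fin m × Fin n`,
reindexed along `finProdFinEquiv : Fin m × Fin n ≃ Fin (m·n)`.  Both directions are tuplings of coordinate homomorphisms, hence
homomorphisms (products and projections of group schemes, [MumfordFogartyKirwan1994, Ch. 6 §1]).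

## Contents

* §1 `powPowProj A m n i k : ((A.pow n).pow m).X ⟶ A.X` (double coordinate), `isMonHom_powPowProj`, `powPow_hom_ext`, `powPowLift` with
  `powPowLift_proj`;
* §2 `powPowToPow`, `powToPowPow`, **`powPowIso A m n : ((A.pow n).pow m).X ≅ (A.pow (m * n)).X`**, `isMonHom_powPowIso` (both directions),
  `powPowIso_hom_powProj : _ ≫ A.powProj (m*n) (finProdFinEquiv (i, k)) = A.powPowProj m n i k`, `powPowIso_inv_proj`.

## References
* [MumfordFogartyKirwan1994] D. Mumford, J. Fogarty, F. Kirwan, *Geometric Invariant Theory*, 3rd ed., Ch. 6 §1 Def. 6.1 (p. 115), Cor. 6.4 (p. 117).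
* [Conrad2004GrossZagier] B. Conrad, *Gross–Zagier revisited*, MSRI Publ. 49 (2004), §7 (where the reindexing is used).
* Tree: ★ `AbelianSchemes/SerreTensorFunctoriality` (FILE 3) and its imports (`pow`, `powProj`, `powLift`, `powHomEquiv`, `powMap`).
-/

noncomputable section

universe u

open CategoryTheory CategoryTheory.Limits AlgebraicGeometry MonoidalCategory CartesianMonoidalCategory
open scoped MonObj

namespace Literature.AlgebraicGeometry.AbelianSchemes

namespace AbelianSchemeOver

variable {S : Scheme.{u}} (A : AbelianSchemeOver S) (m n : ℕ)

/-! ## §1 Double coordinates `pr_{i,k} : (Aⁿ)ᵐ ⟶ A` and the comparison maps -/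

/-- The double coordinate `pr_{i,k} := pr_i ≫ pr_k : (Aⁿ)ᵐ ⟶ A`. [cite: MumfordFogartyKirwan1994, Ch. 6 §1 Definition 6.1 (p. 115)] -/
def powPowProj (i : Fin m) (k : Fin n) : ((A.pow n).pow m).X ⟶ A.X := (A.pow n).powProj m i ≫ A.powProj n k

/-- `pr_{i,k}` is a homomorphism. [cite: MumfordFogartyKirwan1994, Ch. 6 §1 Corollary 6.4 (p. 117)] -/
theorem isMonHom_powPowProj (i : Fin m) (k : Fin n) : IsMonHom (A.powPowProj m n i k) := by
  haveI := (A.pow n).isMonHom_powProj m i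
  haveI := A.isMonHom_powProj n k
  unfold powPowProj
  infer_instance

variable {A m n}

/-- Points of `(Aⁿ)ᵐ` are determined by their double coordinates. [cite: MumfordFogartyKirwan1994, Ch. 6 §1 Definition 6.1 (p. 115)] -/
theorem powPow_hom_ext {T : Over S} {g h : T ⟶ ((A.pow n).pow m).X}
    (hgh : ∀ i k, g ≫ A.powPowProj m n i k = h ≫ A.powPowProj m n i k) : g = h :=
  pow_hom_ext fun i => pow_hom_ext fun k => by simpa only [powPowProj, Category.assoc] using hgh i k

/-- Double tupling: the `T`-point `((f_{i,k})_k)_i` of `(Aⁿ)ᵐ`. [cite: MumfordFogartyKirwan1994, Ch. 6 §1 Definition 6.1 (p. 115)] -/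
def powPowLift {T : Over S} (f : Fin m → Fin n → (T ⟶ A.X)) : T ⟶ ((A.pow n).pow m).X := powLift fun i => powLift (f i)

/-- `((f_{i,k})) ≫ pr_{i,k} = f_{i,k}`. [cite: MumfordFogartyKirwan1994, Ch. 6 §1 Definition 6.1 (p. 115)] -/
@[reassoc (attr := simp)]
theorem powPowLift_proj {T : Over S} (f : Fin m → Fin n → (T ⟶ A.X)) (i : Fin m) (k : Fin n) :
    powPowLift f ≫ A.powPowProj m n i k = f i k := by
  rw [powPowLift, powPowProj, ← Category.assoc, powLift_powProj, powLift_powProj]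

variable (A m n)

/-! ## §2 The isomorphism `(Aⁿ)ᵐ ≅ A^{m·n}` (index pairs `(i, k) ↦ finProdFinEquiv (i, k)`) -/

/-- `(Aⁿ)ᵐ ⟶ A^{m·n}`: coordinate `l ↦ pr_{(l.divNat, l.modNat)}`. [cite: MumfordFogartyKirwan1994, Ch. 6 §1 Definition 6.1 (p. 115)] -/
def powPowToPow : ((A.pow n).pow m).X ⟶ (A.pow (m * n)).X :=
  powLift fun l => A.powPowProj m n (finProdFinEquiv.symm l).1 (finProdFinEquiv.symm l).2

/-- `A^{m·n} ⟶ (Aⁿ)ᵐ`: double coordinate `(i, k) ↦ pr_{finProdFinEquiv (i,k)}`. [cite: MumfordFogartyKirwan1994, Ch. 6 §1 Definition 6.1 (p. 115)] -/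
def powToPowPow : (A.pow (m * n)).X ⟶ ((A.pow n).pow m).X :=
  powPowLift fun i k => A.powProj (m * n) (finProdFinEquiv (i, k))

/-- `powPowToPow ≫ pr_l = pr_{l.divNat, l.modNat}`. [cite: MumfordFogartyKirwan1994, Ch. 6 §1 Definition 6.1 (p. 115)] -/
@[reassoc (attr := simp)]
theorem powPowToPow_powProj (l : Fin (m * n)) :
    A.powPowToPow m n ≫ A.powProj (m * n) l = A.powPowProj m n (finProdFinEquiv.symm l).1 (finProdFinEquiv.symm l).2 := by
  rw [powPowToPow, powLift_powProj]

/-- `powToPowPow ≫ pr_{i,k} = pr_{finProdFinEquiv (i,k)}`. [cite: MumfordFogartyKirwan1994, Ch. 6 §1 Definition 6.1 (p. 115)] -/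
@[reassoc (attr := simp)]
theorem powToPowPow_proj (i : Fin m) (k : Fin n) :
    A.powToPowPow m n ≫ A.powPowProj m n i k = A.powProj (m * n) (finProdFinEquiv (i, k)) := by
  rw [powToPowPow, powPowLift_proj]

/-- **`(Aⁿ)ᵐ ≅ A^{m·n}`** (reindexing the coordinates along `Fin m × Fin n ≃ Fin (m·n)`).
[cite: MumfordFogartyKirwan1994, Ch. 6 §1 Definition 6.1 (p. 115)] -/
def powPowIso : ((A.pow n).pow m).X ≅ (A.pow (m * n)).X where
  hom := A.powPowToPow m n
  inv := A.powToPowPow m n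
  hom_inv_id := powPow_hom_ext fun i k => by
    rw [Category.assoc, powToPowPow_proj, powPowToPow_powProj, Equiv.symm_apply_apply, Category.id_comp]
  inv_hom_id := pow_hom_ext fun l => by
    rw [Category.assoc, powPowToPow_powProj, powToPowPow_proj, Prod.mk.eta, Equiv.apply_symm_apply, Category.id_comp]

/-- Both directions of `(Aⁿ)ᵐ ≅ A^{m·n}` are homomorphisms. [cite: MumfordFogartyKirwan1994, Ch. 6 §1 Corollary 6.4 (p. 117)] -/
theorem isMonHom_powPowIso : IsMonHom (A.powPowIso m n).hom ∧ IsMonHom (A.powPowIso m n).inv := by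
  haveI : IsMonHom (A.powPowIso m n).hom :=
    isMonHom_powLift _ fun l => A.isMonHom_powPowProj m n _ _
  exact ⟨‹_›, inferInstance⟩

/-- `powPowIso.hom ≫ pr_{finProdFinEquiv (i,k)} = pr_{i,k}`. [cite: MumfordFogartyKirwan1994, Ch. 6 §1 Definition 6.1 (p. 115)] -/
@[reassoc (attr := simp)]
theorem powPowIso_hom_powProj (i : Fin m) (k : Fin n) :
    (A.powPowIso m n).hom ≫ A.powProj (m * n) (finProdFinEquiv (i, k)) = A.powPowProj m n i k := by
  change A.powPowToPow m n ≫ _ = _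
  rw [powPowToPow_powProj, Equiv.symm_apply_apply]

/-- `powPowIso.inv ≫ pr_{i,k} = pr_{finProdFinEquiv (i,k)}`. [cite: MumfordFogartyKirwan1994, Ch. 6 §1 Definition 6.1 (p. 115)] -/
@[reassoc (attr := simp)]
theorem powPowIso_inv_proj (i : Fin m) (k : Fin n) :
    (A.powPowIso m n).inv ≫ A.powPowProj m n i k = A.powProj (m * n) (finProdFinEquiv (i, k)) :=
  powToPowPow_proj A m n i k

end AbelianSchemeOver

end Literature.AlgebraicGeometry.AbelianSchemes

end
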